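import Summits.QuantumAdvantage.QuantumAdvantage.Theorems.StabilizerDialGaugeZ
import Summits.QuantumAdvantage.QuantumAdvantage.Theorems.StabilizerDialAntipodal
import Summits.QuantumAdvantage.QuantumAdvantage.Theorems.LocusDialDeclarable
import Summits.QuantumAdvantage.QuantumAdvantage.Theorems.HolonomyDialAvoid

/-!
# SparsityDial — Theorems twin of the g18 node (cell decomp-qadv, seat lens-2; supports item 27138
`StabilizerDial.StabGenericLossPos3`)

Cut verbatim from HOME `decomp-qadv-lens-2/g18/SparsityDial.lean` (record `NODE-g18.md`), namespace
`…Theorems.SparsityDial`, conclusions against the LANDED Theorems-level declarations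
(`Theorems.StabilizerDial.StabGenericLossPos3`, `Theorems.LocusDial.FewLocusLoss3`, `Theses.ExactnessDial.PolyLossOddU3`,
`Theorems.HolonomyDial.AvoidLift3`).  Contents:
* §0 window-budget monotonicity of the saturated classes (`stabFew_mono_mr`, `card_le_of_coverable_zero`);
* §1 the pieces `PointerNormalLoss3` (G₀₀), `SparseGenericLossAt a` / `DenseGenericLossAt a`, `SparseGenericLoss3` (S = ∀ a),
  `DenseGenericLoss3` (D = ∃ a), `PointLoss3` (U₁₀);
* §2 EQUIV `stabGenericLossPos3_iff_pointerNormal : G ⟺ G₀₀`; §2b `polyLossOddU3_iff_point_pointerNormal : T ⟺ U₁₀ ∧ G₀₀`,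
  `polyLossOddU3_iff_one_G : T ⟺ FewLocusLossOne3 ∧ G`;
* §3 the split `pointerNormal_iff_at a : G₀₀ ⟺ S_a ∧ D_a`, `stabGenericLossPos3_iff_sparse_dense : G ⟺ S ∧ D`, corners
  `denseAt_zero_iff`, `sparseAt_zero`, and `closes_pieces : S → D → StabGenericLossPos3` (node name `closes`) (+ junction / parent / leaf forms);
* §4 certificates of strict weakness E1 `apStrat_not_polylogLocal`, `dense_class_nonempty` and E2 `bpStrat_not_pointer`,
  `sparse_generic_class_nonempty`, `split_nondegenerate`;
* §5 rung targets `AntipodalLoss3`, `BlockAntipodalLoss3` with `antipodalLoss3_of_dense`, `blockAntipodalLoss3_of_sparse`.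
No `sorry`; standard axioms; no instances, no notation, no unsafe options.  CUT POINTS for ≤ 400-line parts: before the
section header «§4» (part A = §0–§3d), before the docstring «E2» and before the section header «§5» (parts B, C).
-/

set_option linter.dupNamespace false
set_option linter.unusedVariables false

noncomputable section

open scoped Classical

namespace Summit.QuantumAdvantage.QuantumAdvantage.Theorems.SparsityDial

open Finset
open Literature.Computability.QuantumComplexity Literature.Computability.QuantumComplexity.RingHLF
open Literature.Computability.MetaComplexity Literature.Computability.MetaComplexity.Smolensky
open Summit.QuantumAdvantage.AdviceFreeQNC0
open Summit.QuantumAdvantage.QuantumAdvantage.Theses (ExactnessDial.PolyLossOddU3 ExactnessDial.DPLift3)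
open Summit.QuantumAdvantage.QuantumAdvantage.Theorems.HolonomyDial (selP selP_mem selP_apply xorP xorP_mem
  xorP_apply_bool tPoly tPoly_mem tPoly_apply closes_T)
open Summit.QuantumAdvantage.QuantumAdvantage.Theorems.AnchorDial (outB dev loss_shape_mono card_odd_ge)
open Summit.QuantumAdvantage.QuantumAdvantage.Theorems.LocusDial (Coverable FewLocus FewLocusLossOne3
  coverable_mono_m Coverable.card_le dev_tPoly fewLocusLossOne3_of_fewLocusLoss3)
open Summit.QuantumAdvantage.QuantumAdvantage.Theorems.StabilizerDial (StabFew pad pad_mem winset_pad deg_pad_stab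
  stabFew_of_fewLocus bitP bitP_pad rowMask apIdx apStrat apStrat_mem bitP_apStrat mem_dev_pad_apStrat_iff BlockRec
  fibreIdentityAt_of_block oddSliceBound_holds goodBound_of_blockRec blockSelect_of_fewLocus eventually_polylog
  side_bounds polyLossOddU3_of_stabPos stabGenericLossPos3_of_polyLossOddU3 antipodalGenericPos3)

variable {N : ℕ}

/-! ## §0  Window-budget monotonicity of the classes -/

/-- wider windows cover more. -/
theorem coverable_mono_r {m r r' : ℕ} (hr : r ≤ r') {S : Finset (Fin N)} (h : Coverable m r S) : Coverable m r' S := by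
  obtain ⟨kv, hkv⟩ := h
  refine ⟨kv, fun i hi => ?_⟩
  obtain ⟨j, hj1, hj2⟩ := hkv i hi
  exact ⟨j, hj1, by omega⟩

/-- more and wider windows cover more (`m ≥ 1`). -/
theorem coverable_mono_mr {m m' r r' : ℕ} (hm : m ≤ m') (hm1 : 1 ≤ m) (hr : r ≤ r') {S : Finset (Fin N)}
    (h : Coverable m r S) : Coverable m' r' S :=
  coverable_mono_r hr (coverable_mono_m hm hm1 h)

/-- `FewLocus` is monotone in the window budget. -/
theorem fewLocus_mono {m m' r r' : ℕ} (hm : m ≤ m') (hm1 : 1 ≤ m) (hr : r ≤ r') {P : Fin N → CubeFn (ZMod 3) N}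
    (h : FewLocus m r P) : FewLocus m' r' P := by
  refine le_trans (Nat.mul_le_mul_left _ (card_le_card fun x hx => ?_)) h
  rw [mem_filter] at hx ⊢
  exact ⟨hx.1, hx.2.1, fun hc => hx.2.2 (coverable_mono_mr hm hm1 hr hc)⟩

/-- **`StabFew` is monotone in the window budget** (same gauge): the lever of §1. -/
theorem stabFew_mono_mr {m m' r r' e : ℕ} (hm : m ≤ m') (hm1 : 1 ≤ m) (hr : r ≤ r') {P : Fin N → CubeFn (ZMod 3) N}
    (h : StabFew m r e P) : StabFew m' r' e P := by
  obtain ⟨s, hs, hF⟩ := h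
  exact ⟨s, hs, fewLocus_mono hm hm1 hr hF⟩

/-- width-`0` windows are POINTS: an `(t, 0)`-coverable set has at most `t` elements. -/
theorem card_le_of_coverable_zero {t : ℕ} {S : Finset (Fin N)} (h : Coverable t 0 S) : S.card ≤ t := by
  simpa using h.card_le

/-! ## §1  The pieces -/

/-- **`PointerNormalLoss3` («G₀₀»)** — `G` at `(m, r) = (0, 0)`: eventually every degree-`(log₂ n)^c` strategy that NO
gauge of degree `(log₂ n)^{c+1}` turns into an a.e.-at-most-ONE-POINT strategy (`StabFew 1 0 (c+1)`, a CHEAP POINTER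
NORMAL FORM) loses `≥ n^{-C}` of the odd class.  `⟺ G` (§2). -/
def PointerNormalLoss3 : Prop :=
  ∃ C : ℕ, ∀ c : ℕ, ∃ n₀ : ℕ, ∀ n ≥ n₀, ∀ P : Fin n → CubeFn (ZMod 3) n,
    (∀ i, P i ∈ lowDeg (ZMod 3) n ((Nat.log 2 n) ^ c)) → ¬ StabFew 1 0 (c + 1) P →
      ((univ.filter fun x : Fin n → Bool => OddZeros x ∧ Rel x (fun i => decide (P i x = 1))).card : ℝ) ≤
        (1 - 1 / (n : ℝ) ^ C) * (2 : ℝ) ^ (n - 1)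

/-- **`SparseGenericLossAt a` («S_a», crux; the MULTI-POINTER regime)**: eventually every degree-`(log₂ n)^c` strategy
that SOME gauge of degree `(log₂ n)^{c+1}` turns into an a.e.-`≤ (log₂ n)^a`-POINT strategy, but NONE turns into an
a.e.-`≤ 1`-point strategy, loses `≥ n^{-C}` of the odd class. -/
def SparseGenericLossAt (a : ℕ) : Prop :=
  ∃ C : ℕ, ∀ c : ℕ, ∃ n₀ : ℕ, ∀ n ≥ n₀, ∀ P : Fin n → CubeFn (ZMod 3) n,
    (∀ i, P i ∈ lowDeg (ZMod 3) n ((Nat.log 2 n) ^ c)) →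
    StabFew ((Nat.log 2 n) ^ a) 0 (c + 1) P → ¬ StabFew 1 0 (c + 1) P →
      ((univ.filter fun x : Fin n → Bool => OddZeros x ∧ Rel x (fun i => decide (P i x = 1))).card : ℝ) ≤
        (1 - 1 / (n : ℝ) ^ C) * (2 : ℝ) ^ (n - 1)

/-- **`DenseGenericLossAt a` («D_a», crux; the XOR regime)**: eventually every degree-`(log₂ n)^c` strategy that NO gauge
of degree `(log₂ n)^{c+1}` turns into an a.e.-`≤ (log₂ n)^a`-point strategy loses `≥ n^{-C}` of the odd class. -/
def DenseGenericLossAt (a : ℕ) : Prop :=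
  ∃ C : ℕ, ∀ c : ℕ, ∃ n₀ : ℕ, ∀ n ≥ n₀, ∀ P : Fin n → CubeFn (ZMod 3) n,
    (∀ i, P i ∈ lowDeg (ZMod 3) n ((Nat.log 2 n) ^ c)) → ¬ StabFew ((Nat.log 2 n) ^ a) 0 (c + 1) P →
      ((univ.filter fun x : Fin n → Bool => OddZeros x ∧ Rel x (fun i => decide (P i x = 1))).card : ℝ) ≤
        (1 - 1 / (n : ℝ) ^ C) * (2 : ℝ) ^ (n - 1)

/-- **PIECE S = `SparseGenericLoss3`**: the multi-pointer regime at EVERY polylog sparsity scale. -/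
def SparseGenericLoss3 : Prop := ∀ a : ℕ, SparseGenericLossAt a

/-- **PIECE D = `DenseGenericLoss3`**: the XOR regime beyond SOME polylog sparsity scale (the prover names the scale). -/
def DenseGenericLoss3 : Prop := ∃ a : ℕ, DenseGenericLossAt a

/-- **`PointLoss3` («U₁₀»)** — the ONE-POINT slice of the sibling crux U = `FewLocusLoss3`: eventually every
degree-`(log₂ n)^c` strategy whose deviation set has a.e. at most one point loses `≥ n^{-C}` of the odd class. -/
def PointLoss3 : Prop :=
  ∃ C : ℕ, ∀ c : ℕ, ∃ n₀ : ℕ, ∀ n ≥ n₀, ∀ P : Fin n → CubeFn (ZMod 3) n,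
    (∀ i, P i ∈ lowDeg (ZMod 3) n ((Nat.log 2 n) ^ c)) → FewLocus 1 0 P →
      ((univ.filter fun x : Fin n → Bool => OddZeros x ∧ Rel x (fun i => decide (P i x = 1))).card : ℝ) ≤
        (1 - 1 / (n : ℝ) ^ C) * (2 : ℝ) ^ (n - 1)

/-! ## §2  EQUIV: `G ⟺ G₀₀` (windows are irrelevant on the generic side) -/

/-- `G → G₀₀` (the instance `(m, r) = (0, 0)`). -/
theorem pointerNormal_of_G (h : StabilizerDial.StabGenericLossPos3) : PointerNormalLoss3 := by
  obtain ⟨C, hC⟩ := h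
  refine ⟨C, fun c => ?_⟩
  obtain ⟨n₀, hn₀⟩ := hC 0 0 c
  exact ⟨n₀, fun n hn P hP hG => hn₀ n hn P hP (by simpa using hG)⟩

/-- `G₀₀ → G`: a strategy generic at `(m+1, r)` is generic at `(1, 0)` (`stabFew_mono_mr`). -/
theorem G_of_pointerNormal (h : PointerNormalLoss3) : StabilizerDial.StabGenericLossPos3 := by
  obtain ⟨C, hC⟩ := h
  refine ⟨C, fun m r c => ?_⟩
  obtain ⟨n₀, hn₀⟩ := hC c
  exact ⟨n₀, fun n hn P hP hG => hn₀ n hn P hP fun h1 => hG (stabFew_mono_mr (by omega) le_rfl (Nat.zero_le r) h1)⟩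

/-- **EQUIV `G ⟺ G₀₀`.** -/
theorem stabGenericLossPos3_iff_pointerNormal : StabilizerDial.StabGenericLossPos3 ↔ PointerNormalLoss3 :=
  ⟨pointerNormal_of_G, G_of_pointerNormal⟩

/-- `T → G₀₀` (restriction). -/
theorem pointerNormal_of_T (h : ExactnessDial.PolyLossOddU3) : PointerNormalLoss3 :=
  pointerNormal_of_G (stabGenericLossPos3_of_polyLossOddU3 h)

/-! ## §2b  COROLLARY for the sibling crux: `T ⟺ U₁₀ ∧ G₀₀`, hence `T ⟺ FewLocusLossOne3 ∧ G` -/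

/-- `U → U₁₀` (the instance `(m, r) = (1, 0)`). -/
theorem pointLoss3_of_U (h : Summit.QuantumAdvantage.QuantumAdvantage.Theorems.LocusDial.FewLocusLoss3) : PointLoss3 := by
  obtain ⟨C, hC⟩ := h
  exact ⟨C, fun c => hC 1 0 c⟩

/-- `FewLocusLossOne3 → U₁₀` (the instance `r = 0`). -/
theorem pointLoss3_of_one (h : FewLocusLossOne3) : PointLoss3 := by
  obtain ⟨C, hC⟩ := h
  exact ⟨C, fun c => hC 0 c⟩

/-- `T → U₁₀` (restriction). -/
theorem pointLoss3_of_T (h : ExactnessDial.PolyLossOddU3) : PointLoss3 := by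
  obtain ⟨C, hC⟩ := h
  refine ⟨C, fun c => ?_⟩
  obtain ⟨n₀, hn₀⟩ := hC c
  exact ⟨n₀, fun n hn P hP _ => hn₀ n hn P hP⟩

/-- **dichotomy `U₁₀ ∧ G₀₀ → T`**: at degree budget `c` split on `StabFew 1 0 (c+1) P`; a cheap pointer normal form is a
ONE-POINT strategy of degree `≤ (log₂ n)^{c+2}` with the same win set (`winset_pad`), discharged by `U₁₀`; otherwise `G₀₀`. -/
theorem T_of_point_pointerNormal (hU : PointLoss3) (hG : PointerNormalLoss3) : ExactnessDial.PolyLossOddU3 := by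
  obtain ⟨CU, hU⟩ := hU
  obtain ⟨CG, hG⟩ := hG
  refine ⟨max CU CG, fun c => ?_⟩
  obtain ⟨n₁, hn₁⟩ := hU (c + 2)
  obtain ⟨n₂, hn₂⟩ := hG c
  refine ⟨max (max n₁ n₂) 512, fun n hn P hP => ?_⟩
  have hn1 : n₁ ≤ n := le_trans (le_trans (le_max_left _ _) (le_max_left _ _)) hn
  have hn2 : n₂ ≤ n := le_trans (le_trans (le_max_right _ _) (le_max_left _ _)) hn
  have h512 : 512 ≤ n := le_trans (le_max_right _ _) hn
  have h1 : 1 ≤ n := by omega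
  have hP0 : (0 : ℝ) ≤ (2 : ℝ) ^ (n - 1) := by positivity
  by_cases hS : StabFew 1 0 (c + 1) P
  · obtain ⟨s, hs, hF⟩ := hS
    have hdeg : ∀ i, pad P s i ∈ lowDeg (ZMod 3) n ((Nat.log 2 n) ^ (c + 2)) := fun i =>
      lowDeg_mono (deg_pad_stab n c h512) (pad_mem hP hs i)
    have h := hn₁ n hn1 (pad P s) hdeg hF
    rw [winset_pad] at h
    exact loss_shape_mono h1 (le_max_left CU CG) _ _ hP0 h
  · exact loss_shape_mono h1 (le_max_right CU CG) _ _ hP0 (hn₂ n hn2 P hP hS)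

/-- **`T ⟺ U₁₀ ∧ G₀₀`**: the junction needs exactly «one cheap pointer loses» and «near-perfect ⟹ cheap pointer normal form». -/
theorem polyLossOddU3_iff_point_pointerNormal : ExactnessDial.PolyLossOddU3 ↔ PointLoss3 ∧ PointerNormalLoss3 :=
  ⟨fun h => ⟨pointLoss3_of_T h, pointerNormal_of_T h⟩, fun h => T_of_point_pointerNormal h.1 h.2⟩

/-- **`T ⟺ FewLocusLossOne3 ∧ G`** BY NAME (tree `Theorems.LocusDial.FewLocusLossOne3`, route item `StabGenericLossPos3`):
the multi-window content of U is off the critical path. -/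
theorem polyLossOddU3_iff_one_G :
    ExactnessDial.PolyLossOddU3 ↔ FewLocusLossOne3 ∧ StabilizerDial.StabGenericLossPos3 :=
  ⟨fun h => ⟨fewLocusLossOne3_of_fewLocusLoss3 (Theorems.LocusDial.fewLocusLoss3_of_polyLossOddU3 h),
      stabGenericLossPos3_of_polyLossOddU3 h⟩,
    fun h => T_of_point_pointerNormal (pointLoss3_of_one h.1) (pointerNormal_of_G h.2)⟩

/-! ## §3  THE SPLIT `G₀₀ ⟺ S_a ∧ D_a` at every scale, and `G ⟺ S ∧ D` -/

/-- `1 ≤ (log₂ n)^a` once `n ≥ 2`. -/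
theorem one_le_logpow {n : ℕ} (hn : 2 ≤ n) (a : ℕ) : 1 ≤ (Nat.log 2 n) ^ a :=
  Nat.one_le_pow _ _ (Nat.le_log_of_pow_le (by norm_num) (by simpa using hn))

/-- `G₀₀ → S_a` (restriction). -/
theorem sparseAt_of_pointerNormal (a : ℕ) (h : PointerNormalLoss3) : SparseGenericLossAt a := by
  obtain ⟨C, hC⟩ := h
  refine ⟨C, fun c => ?_⟩
  obtain ⟨n₀, hn₀⟩ := hC c
  exact ⟨n₀, fun n hn P hP _ hG => hn₀ n hn P hP hG⟩

/-- `G₀₀ → D_a` (restriction: no `(log₂ n)^a`-point normal form ⟹ no one-point normal form). -/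
theorem denseAt_of_pointerNormal (a : ℕ) (h : PointerNormalLoss3) : DenseGenericLossAt a := by
  obtain ⟨C, hC⟩ := h
  refine ⟨C, fun c => ?_⟩
  obtain ⟨n₀, hn₀⟩ := hC c
  refine ⟨max n₀ 2, fun n hn P hP hD => hn₀ n (le_of_max_le_left hn) P hP fun h1 => hD ?_⟩
  exact stabFew_mono_mr (one_le_logpow (le_of_max_le_right hn) a) le_rfl le_rfl h1

/-- **dichotomy `S_a ∧ D_a → G₀₀`** at scale `a` (same strategy, no padding: split on `StabFew ((log₂ n)^a) 0 (c+1) P`). -/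
theorem pointerNormal_of_at {a : ℕ} (hS : SparseGenericLossAt a) (hD : DenseGenericLossAt a) : PointerNormalLoss3 := by
  obtain ⟨CS, hS⟩ := hS
  obtain ⟨CD, hD⟩ := hD
  refine ⟨max CS CD, fun c => ?_⟩
  obtain ⟨n₁, hn₁⟩ := hS c
  obtain ⟨n₂, hn₂⟩ := hD c
  refine ⟨max (max n₁ n₂) 1, fun n hn P hP hG => ?_⟩
  have hn1 : n₁ ≤ n := le_trans (le_trans (le_max_left _ _) (le_max_left _ _)) hn
  have hn2 : n₂ ≤ n := le_trans (le_trans (le_max_right _ _) (le_max_left _ _)) hn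
  have h1 : 1 ≤ n := le_trans (le_max_right _ _) hn
  have hP0 : (0 : ℝ) ≤ (2 : ℝ) ^ (n - 1) := by positivity
  by_cases h : StabFew ((Nat.log 2 n) ^ a) 0 (c + 1) P
  · exact loss_shape_mono h1 (le_max_left CS CD) _ _ hP0 (hn₁ n hn1 P hP h hG)
  · exact loss_shape_mono h1 (le_max_right CS CD) _ _ hP0 (hn₂ n hn2 P hP h)

/-- **NODE EQUATION AT SCALE `a`**: `G₀₀ ⟺ S_a ∧ D_a`. -/
theorem pointerNormal_iff_at (a : ℕ) : PointerNormalLoss3 ↔ SparseGenericLossAt a ∧ DenseGenericLossAt a :=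
  ⟨fun h => ⟨sparseAt_of_pointerNormal a h, denseAt_of_pointerNormal a h⟩, fun h => pointerNormal_of_at h.1 h.2⟩

/-- `D_a` is MONOTONE in the scale (the class shrinks). -/
theorem denseAt_mono {a a' : ℕ} (haa : a ≤ a') (h : DenseGenericLossAt a) : DenseGenericLossAt a' := by
  obtain ⟨C, hC⟩ := h
  refine ⟨C, fun c => ?_⟩
  obtain ⟨n₀, hn₀⟩ := hC c
  refine ⟨max n₀ 2, fun n hn P hP hD => hn₀ n (le_of_max_le_left hn) P hP fun h1 => hD ?_⟩
  exact stabFew_mono_mr (Nat.pow_le_pow_right (Nat.le_log_of_pow_le (by norm_num)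
    (by simpa using le_of_max_le_right hn)) haa) (one_le_logpow (le_of_max_le_right hn) a) le_rfl h1

/-- `S_a` is ANTITONE in the scale (the class grows). -/
theorem sparseAt_anti {a a' : ℕ} (haa : a ≤ a') (h : SparseGenericLossAt a') : SparseGenericLossAt a := by
  obtain ⟨C, hC⟩ := h
  refine ⟨C, fun c => ?_⟩
  obtain ⟨n₀, hn₀⟩ := hC c
  refine ⟨max n₀ 2, fun n hn P hP hS hG => hn₀ n (le_of_max_le_left hn) P hP ?_ hG⟩
  exact stabFew_mono_mr (Nat.pow_le_pow_right (Nat.le_log_of_pow_le (by norm_num)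
    (by simpa using le_of_max_le_right hn)) haa) (one_le_logpow (le_of_max_le_right hn) a) le_rfl hS

/-- **NODE EQUATION, parameter-free**: `G₀₀ ⟺ S ∧ D`. -/
theorem pointerNormal_iff_sparse_dense : PointerNormalLoss3 ↔ SparseGenericLoss3 ∧ DenseGenericLoss3 :=
  ⟨fun h => ⟨fun a => sparseAt_of_pointerNormal a h, ⟨0, denseAt_of_pointerNormal 0 h⟩⟩,
    fun ⟨hS, ⟨a, hD⟩⟩ => pointerNormal_of_at (hS a) hD⟩

/-- **NODE EQUATION on the route item**: `G ⟺ S ∧ D`. -/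
theorem stabGenericLossPos3_iff_sparse_dense :
    StabilizerDial.StabGenericLossPos3 ↔ SparseGenericLoss3 ∧ DenseGenericLoss3 :=
  stabGenericLossPos3_iff_pointerNormal.trans pointerNormal_iff_sparse_dense

/-- necessity `T → S`. -/
theorem sparse_of_T (h : ExactnessDial.PolyLossOddU3) : SparseGenericLoss3 :=
  (pointerNormal_iff_sparse_dense.mp (pointerNormal_of_T h)).1

/-- necessity `T → D`. -/
theorem dense_of_T (h : ExactnessDial.PolyLossOddU3) : DenseGenericLoss3 :=
  (pointerNormal_iff_sparse_dense.mp (pointerNormal_of_T h)).2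

/-! ### §3c  Corners, typed -/

/-- the scale-`0` dense piece IS `G₀₀` (`(log₂ n)^0 = 1`): hence `D := ∃ a, D_a`, never `∀ a`. -/
theorem denseAt_zero_iff : DenseGenericLossAt 0 ↔ PointerNormalLoss3 := by
  unfold DenseGenericLossAt PointerNormalLoss3
  simp only [pow_zero]

/-- the scale-`0` sparse piece is VACUOUS (its two hypotheses contradict each other). -/
theorem sparseAt_zero : SparseGenericLossAt 0 :=
  ⟨0, fun c => ⟨0, fun n _ P _ hS hG => absurd (by simpa using hS) hG⟩⟩

/-! ## §3d  `closes_pieces` (node: `closes`; renamed for landing — the gate reserves the bare name `closes` in helper files) — the pieces decide the route item BY NAME, and everything above it -/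

/-- **`closes_pieces`** (the node's `closes`, renamed for landing): `S → D → Theorems.StabilizerDial.StabGenericLossPos3` (the text of item 27138 verbatim). -/
theorem closes_pieces (hS : SparseGenericLoss3) (hD : DenseGenericLoss3) :
    Summit.QuantumAdvantage.QuantumAdvantage.Theorems.StabilizerDial.StabGenericLossPos3 :=
  G_of_pointerNormal (pointerNormal_iff_sparse_dense.mpr ⟨hS, hD⟩)

/-- with the sibling crux U (27137): the junction 26531. -/
theorem closes_junction (hU : Summit.QuantumAdvantage.QuantumAdvantage.Theorems.LocusDial.FewLocusLoss3)
    (hS : SparseGenericLoss3) (hD : DenseGenericLoss3) :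
    ExactnessDial.PolyLossOddU3 :=
  polyLossOddU3_of_stabPos hU (closes_pieces hS hD)

/-- … the parent route's residual `HolonomyDial.AvoidLift3` (34246). -/
theorem closes_parent (hU : Summit.QuantumAdvantage.QuantumAdvantage.Theorems.LocusDial.FewLocusLoss3)
    (hS : SparseGenericLoss3) (hD : DenseGenericLoss3) :
    Summit.QuantumAdvantage.QuantumAdvantage.Theorems.HolonomyDial.AvoidLift3 :=
  fun _ => closes_junction hU hS hD

/-- … and the rung leaf `AdviceFreeQNC0Three` under the cone's standing outer lift `DPLift3` (26124). -/
theorem closes_leaf (hU : Summit.QuantumAdvantage.QuantumAdvantage.Theorems.LocusDial.FewLocusLoss3)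
    (hS : SparseGenericLoss3) (hD : DenseGenericLoss3)
    (hDP : ExactnessDial.DPLift3) :
    Summit.QuantumAdvantage.AdviceFreeQNC0.AdviceFreeQNC0Three :=
  closes_T (closes_junction hU hS hD) hDP

/-- the sharpest assembly: ONE-POINT slice of U, S and D give the junction. -/
theorem closes_sharp (hU : PointLoss3) (hS : SparseGenericLoss3) (hD : DenseGenericLoss3) :
    ExactnessDial.PolyLossOddU3 :=
  T_of_point_pointerNormal hU (pointerNormal_iff_sparse_dense.mpr ⟨hS, hD⟩)


end Summit.QuantumAdvantage.QuantumAdvantage.Theorems.SparsityDial
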